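import Summits.BirchSwinnertonDyer.BirchSwinnertonDyer.Theorems.SignedLowerHalvesSmallImageLowerHalfBothSignsRttD2SeqJ3Junction
import Summits.BirchSwinnertonDyer.BirchSwinnertonDyer.Theorems.SignedLowerHalvesSmallImageLowerHalfBothSignsRttD2SeqJ3Good
import Summits.BirchSwinnertonDyer.BirchSwinnertonDyer.Theorems.SignedLowerHalvesSmallImageLowerHalfBothSignsRttD2SeqJ3Strict
import Summits.BirchSwinnertonDyer.BirchSwinnertonDyer.Theorems.SignedLowerHalvesSmallImageLowerHalfBothSignsRttD2SeqJ3Finite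
import HarnessLib

/-!
# Route `SignedLowerHalves`, crux L `SmallImageLowerHalfBothSigns` (stmt-BirchSwinnertonDyer-23599), line `rtt_w3` v14 → v15 — E2, row J3 (Galois side):
# J3 — `j₀ : B′ →ₗ[Λ_𝒪] DQ.X` with `Function.Exact j₀ gX` on the strict carrier — CLOSED MODULO THREE FINITE-LEVEL INPUTS (coefficient pairings, reciprocity `hrecL`, solvability `hsolL`)

WIDTH seat `bsd-line-slh-p3-w3` g22 under LEAD `cruxlead-stmt-BirchSwinnertonDyer-23599` g11 (cell `bsd-ssimc`); helper `--supports stmt-BirchSwinnertonDyer-23599`. ONE THEOREM.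
HONEST FRAMING: the one-call form of the J3 assembly (p784993) with EVERY STRUCTURAL binder discharged by this seat's files — the finite-level pairing socket by the inhabitant
`layerPairingOf` (p789748: local Tate pairings of the layers `inv_{U_{n,v}}(loc y ∪ ℓ)/p^k`, p786363/p787141/p789311), the strict sets by `strictLevel` (p790019, RULING (F1)) with
their `Λ_𝒪`-stability and transition closure, finiteness by `finite_cycLayerCohO_one` (p789821), the good sets by `goodLevel` (p790157). What is LEFT as hypotheses is MATHEMATICS at
finite level `(n,k)`, not plumbing: (1) the coefficient pairings `Pk : X_k × M[p^k] → μ_{p^k}` with `hPred`/`hPsc` (trace form for the consumer's `M`), (2) `hrecL` — the Poitou–Tate sum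
formula at `K_n` (a strict class pairs to zero with `loc_{v,n}` of every Selmer class), (3) `hsolL` — finite-level solvability (Poitou–Tate exactness + local duality at `K_m`). E2, crux L,
crux M and BSD remain OPEN and are proved for NO curve.

★★★ `exists_junction_exact_of_inputs`. References: [Kobayashi2003] Thm. 7.3 i); [Rubin2000] Thm. 1.7.3, §4.2; [NeukirchSchmidtWingberg2008] I §5, (7.2.6), VIII §6; [Kato2004Asterisque] §17.13.
-/

set_option autoImplicit false
set_option linter.dupNamespace false -- D-0017: single-problem summit, the namespace repeats the problem name by design
noncomputable section

open scoped Classical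
open NumberField IsDedekindDomain Field

namespace Summit.BirchSwinnertonDyer.BirchSwinnertonDyer.Theorems.SmallImageRttD2Seq

open Literature.NumberTheory.EllipticCurves Literature.NumberTheory.EllipticCurves.Kobayashi2003
  Literature.NumberTheory.EllipticCurves.GreenbergVatsal2000 Literature.NumberTheory.GaloisRepresentations Literature.NumberTheory.GaloisCohomology
  Literature.NumberTheory.ComplexMultiplication.EllipticUnits.JohnsonLeungKings2011
  Summit.BirchSwinnertonDyer.BirchSwinnertonDyer.Theorems.SmallImageCharSignedSelmer
  Summit.BirchSwinnertonDyer.BirchSwinnertonDyer.Theorems.SmallImageRttD2J1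

section Assembly

variable {K : Type} [Field K] [NumberField K] {p : ℕ} [Fact p.Prime] {κ : ZpExtension K p} {γ : absoluteGaloisGroup K}
  (S : Set (PadicAlgCl p)) [FiniteDimensional ℚ_[p] (padicCoeffField S)]
  {M : Type} [AddCommGroup M] [DistribMulAction (absoluteGaloisGroup K) M] [TopologicalSpace M] [DiscreteTopology M]
  [Module (padicCoeffIntegers S) M] [SMulCommClass (absoluteGaloisGroup K) (padicCoeffIntegers S) M]
  {V : WeierstrassCurve K} {j : V.geomPrimaryTorsion p →+ M} {S₀ : Set (HeightOneSpectrum (𝓞 K))} {ε : ℤˣ}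
  (D : SignedTransportDualDataSat κ γ M (padicCoeffIntegers S) V j S₀ ε)
  {v : HeightOneSpectrum (𝓞 K)} [DistribMulAction (absoluteGaloisGroup (v.adicCompletion K)) M]
  [SMulCommClass (absoluteGaloisGroup (v.adicCompletion K)) (padicCoeffIntegers S) M]
  {γv : absoluteGaloisGroup (v.adicCompletion K)} (DQ : LocalCondDualData κ M (padicCoeffIntegers S) V j ε v γv)
  (hres : ∀ (σ : absoluteGaloisGroup (v.adicCompletion K)) (m : M), σ • m = resGalOfEmb (closureEmb (K := K) (v.adicCompletion K)) σ • m)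
  (hvp : (p : 𝓞 K) ∈ v.asIdeal)
  {γB : absoluteGaloisGroup K} {θ' : absoluteGaloisGroup K →ₜ* (padicCoeffIntegers S)ˣ} {P : Set (HeightOneSpectrum (𝓞 K))}
  (I : CycIwasawaCohomologyDataO S κ γB θ' P 1)
  (hstab : ∀ m : M, IsOpen (MulAction.stabilizer (absoluteGaloisGroup (v.adicCompletion K)) m : Set (absoluteGaloisGroup (v.adicCompletion K))))
  (Pk : ∀ k : ℕ, ContPairing (locCoeffRep S θ' P v k).toTopRep (torsRep M hstab p k).toTopRep (muAt K (p ^ k) v).toTopRep)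

/-- ★★★ **J3 CLOSED MODULO THREE FINITE-LEVEL INPUTS.** For honda's pinned datum `I` at a generator `γ_B` with `γ_B · res_v(γ_v) ∈ ker κ` (RULING (F2)), `K_∞/K` unramified outside the
finite set `P`, `v ∣ p` non-split in `K_∞`, a discrete `p`-primary `M` with open stabilisers, GIVEN (1) coefficient pairings `Pk` compatible with reduction/inclusion (`hPred`) and balanced
for `𝒪` (`hPsc`), (2) the LAYERWISE RECIPROCITY `hrecL` and (3) the LAYERWISE SOLVABILITY `hsolL` — both for the concrete pairings `⟨y, ℓ⟩_{n,k} = inv_{U_{n,v}}(loc_{n,v} y ∪ ℓ)/p^k`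
of `layerPairingOf`, the strict sets `strictLevel … S₀` and the good sets `goodLevel` —, there is a `Λ_𝒪`-linear `j₀ : B′ →ₗ DQ.X` on the STRICT CARRIER
`B′ = strictCarrier I (strictLevel …)` with `DQ.toDual ∘ j₀ = P|_{B′}` and `Function.Exact j₀ gX`: the binders `j₀`/`hexact` of the LEAD's depleted E2 consumer
(`charRoad_E2_of_depleted_junction_tails`, p784278). [cite: Kobayashi2003, Thm. 7.3 i)] [cite: Rubin2000, Thm. 1.7.3, §4.2] [cite: NeukirchSchmidtWingberg2008, (7.2.6), VIII §6]
[cite: Kato2004Asterisque, §17.13] -/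
theorem exists_junction_exact_of_inputs (instX : Module (IwasawaAlgebraO S) D.X) (instQ : Module (IwasawaAlgebraO S) DQ.X)
    (hιX : ∀ (f : IwasawaAlgebra p) (x : D.X), (letI := instX; iwasawaToIwasawaO S f • x) = f • x)
    (hιQ : ∀ (f : IwasawaAlgebra p) (x : DQ.X), (letI := instQ; iwasawaToIwasawaO S f • x) = f • x)
    (hCX : ∀ (a : padicCoeffIntegers S) (x : D.X) (s : signedTransportSelmerInftySat κ M (padicCoeffIntegers S) V j S₀ ε),
      D.toDual (letI := instX; (PowerSeries.C a : IwasawaAlgebraO S) • x) s =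
        D.toDual x ⟨GreenbergSelmer.scalarH1 κ.kerSubgroup M a s, scalarH1_mem_signedTransportSelmerInftySat κ M (padicCoeffIntegers S) V j S₀ ε a s.2⟩)
    (hCQ : ∀ (a : padicCoeffIntegers S) (x : DQ.X) (c : localCondInftySat κ M (padicCoeffIntegers S) V j ε v),
      DQ.toDual (letI := instQ; (PowerSeries.C a : IwasawaAlgebraO S) • x) c = DQ.toDual x (scalarLocalSat κ M (padicCoeffIntegers S) V j ε v a c))
    (htor : ∀ m : M, ∃ k : ℕ, p ^ k • m = 0)
    (hstabK : ∀ m : M, IsOpen (MulAction.stabilizer (absoluteGaloisGroup K) m : Set (absoluteGaloisGroup K)))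
    (hγ : κ.IsTopGenerator γ) (hv : AcSigned.IsNonsplitIn κ v) (hγv : κ.IsTopGenerator (resGalOfEmb (closureEmb (K := K) (v.adicCompletion K)) γv))
    (hγB : γB * resGalOfEmb (closureEmb (K := K) (v.adicCompletion K)) γv ∈ κ.kerSubgroup)
    (hNP : ∀ n, ramificationSubgroup K P ≤ κ.layerSubgroup n) (hP : P.Finite)
    (hPred : ∀ (k : ℕ) (x : ↥(Representation.invariants ((muTwistO S θ' (k + 1)).toRepresentation.comp (ramificationSubgroup K P).subtype))) (m : ↥(torsionPow M p k)),
      (Pk (k + 1)).toLin x (AddSubgroup.inclusion (torsionPow_mono (M := M) (p := p) (Nat.le_succ k)) m) =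
        muInclusion K (pow_dvd_pow p (Nat.le_succ k)) ((Pk k).toLin (coeffMapO S P θ' (oMuRed S k) (oMuRed_muTwistO S θ' k) x) m))
    (hPsc : ∀ (k : ℕ) (a : padicCoeffIntegers S) (x : ↥(Representation.invariants ((muTwistO S θ' k).toRepresentation.comp (ramificationSubgroup K P).subtype)))
      (m : ↥(torsionPow M p k)), (Pk k).toLin (coeffMapO S P θ' (oMuScalar S (p ^ k) a) (oMuScalar_muTwistO S θ' k a) x) m = (Pk k).toLin x (a • m))
    (hrecL : ∀ (n : ℕ) (b : I.H), (∀ n k : ℕ, I.proj n k b ∈ strictLevel S κ θ' P S₀ n k) → ∀ c : subgroupH1 (κ.layerSubgroup n) M,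
      c ∈ signedTransportSelmerLayerSat κ M (padicCoeffIntegers S) V j S₀ ε n →
        (layerPairingOf S κ θ' P v M hstab Pk htor γB γv hγB hNP hv hPred hPsc).pairLayer n b (locH1Layer κ M v hres n c) = 0)
    (hsolL : ∀ q : localCondInftySat κ M (padicCoeffIntegers S) V j ε v →+ AddCircle (1 : ℚ),
      (∀ s : signedTransportSelmerInftySat κ M (padicCoeffIntegers S) V j S₀ ε, q (locSat κ M (padicCoeffIntegers S) V j S₀ ε v hres hvp s) = 0) →
      ∀ m : ℕ, ∃ y ∈ strictLevel S κ θ' P S₀ m m,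
        ∀ (ℓ : subgroupH1 (localSubgroupOfEmb (κ.layerSubgroup m) (closureEmb (K := K) (v.adicCompletion K))) ↥(torsionPow M p m))
          (hℓ : ℓ ∈ goodLevel S κ v M V j ε m m), locPairNK S κ θ' P v M hstab Pk m m y ℓ = q ⟨_, hℓ⟩) :
    letI := instX; letI := instQ
    ∃ j₀ : strictCarrier I (strictLevel S κ θ' P S₀) (fun n k f _ hy ↦ smul_mem_strictLevel S κ θ' P S₀ γB n k f hy) →ₗ[IwasawaAlgebraO S] DQ.X,
      (∀ b, DQ.toDual (j₀ b) = strictPairing (layerPairingOf S κ θ' P v M hstab Pk htor γB γv hγB hNP hv hPred hPsc) I (strictLevel S κ θ' P S₀)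
        (fun n k f _ hy ↦ smul_mem_strictLevel S κ θ' P S₀ γB n k f hy) hstab b) ∧
      Function.Exact j₀ (gXLinearMapO S D DQ hres hvp instX instQ hιX hιQ hCX hCQ htor hstabK hstab hγ hv hγv) :=
  exists_junction_exact_of_layerPairing S D DQ hres hvp (layerPairingOf S κ θ' P v M hstab Pk htor γB γv hγB hNP hv hPred hPsc) I (strictLevel S κ θ' P S₀)
    (fun n k f _ hy ↦ smul_mem_strictLevel S κ θ' P S₀ γB n k f hy) instX instQ hιX hιQ hCX hCQ htor hstabK hstab hγ hv hγv
    (fun n k ↦ finite_cycLayerCohO_one S θ' P κ hP n k)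
    (fun hn _ _ hk _ hy ↦ coresLE_redLE_mem_strictLevel S κ θ' P S₀ hn hk hy)
    (goodLevel S κ v M V j ε)
    (fun n k ℓ hℓ ↦ layerPairingOf_hgoodE S κ v M V j ε θ' P hstab Pk htor γB γv hγB hNP hv hPred hPsc n k ℓ hℓ)
    (fun c ↦ layerPairingOf_hgood S κ v M V j ε θ' P hstab Pk htor γB γv hγB hNP hv hPred hPsc c)
    (fun hn _ _ hk ℓ hℓ ↦ layerPairingOf_hgood_mono S κ v M V j ε θ' P hstab Pk htor γB γv hγB hNP hv hPred hPsc hn hk ℓ hℓ)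
    hrecL hsolL

end Assembly

end Summit.BirchSwinnertonDyer.BirchSwinnertonDyer.Theorems.SmallImageRttD2Seq

end
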